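import Mathlib
import Literature.LinearAlgebra.Matrix.FaddeevLeVerrier
import HarnessLib

/-!
# ValiantsHypothesis / SymPencil — crux `SymmetrizePermPairs` (stmt-ValiantsHypothesis-17793),
# stub `stub_induce`, step (C3a): the Le Verrier DAG of a covariant family of square matrices

Helper layer for the OPEN stub `stub_induce` (merged-desk RULING #195, task (C3) of the memo
`NOTE-p7g11-17793-C3-equivariantGKKP-sizing.md`, ABP/DAG model announced on the val-lit bus
2026-08-28T04:06Z; companion of `…DagSymmetricPencil.lean`).

For a family `M₀, …, M_{R-1}` of `m × m` matrices over a commutative ring `S` (`m ≥ 1`) and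
constants `κ_l` with `κ_l · (m - l) = -1` (`l < m`), `exists_leVerrierDag` produces an explicit
edge-weighted graded DAG on the vertex type
`((Fin R × (Fin m × (Fin m × Fin m))) ⊕ (Fin R × Fin m)) ⊕ Unit`
(vertices `N^{(i)}_l(j,k)` = the entries of the Faddeev–LeVerrier matrices `N_l(M_i)`
(`Literature.LinearAlgebra.Matrix.flMat`), `c^{(i)}_l` = the coefficients of `χ_{M_i}`, and one
shared sink `t`) whose edge weights are `0`, `1`, entries `M_i j k` or `κ_l · M_i j k`, such that

* the value vector `y` (`y(N^{(i)}_l(j,k)) = N_l(M_i)_{jk}`, `y(c^{(i)}_l) = [X^l] χ_{M_i}`,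
  `y(t) = 1`) solves the path recursion `y = E *ᵥ y + δ_t` — this IS the Faddeev–LeVerrier
  recursion `N_l = M N_{l+1} + c_{l+1} 1`, `(m - l) c_l = -tr(M N_l)`, `N_{m-1} = 1` of the tree
  (`flMat_eq_mul_add`, `sub_mul_charpoly_coeff`, `flMat_card_sub_one`);
* the source weights `a = Σ_i δ_{c^{(i)}_0}` give the value `a ⬝ᵥ y = Σ_i det(-M_i)`
  (`charpoly_coeff_zero_eq_det_neg`);
* **covariance**: a ring endomorphism `φ` fixing the `κ_l` and acting on the family by a block
  permutation `τ` and simultaneous conjugations, `φ (M_i j k) = M_{τ i} (P_i j) (P_i k)`, is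
  transported by an explicit DAG automorphism `θ` fixing `t` (`φ (E u v) = E (θ u) (θ v)`,
  `φ (a v) = a (θ v)`).

With `…DagSymmetricPencil.lean` this yields a symmetric affine pencil of size
`2 R (m³ + m) + 3` with determinant `± 2 Σ_i det(-M_i)`, covariant under the same data — the
SUM model that `stub_induce` needs (the located obstruction of the memo: products give `per^R`).
No new definitions (the DAG is an explicit term inside the existential), no named facts.
Honest framing: helper layer for an OPEN stub of an OPEN crux; `VP ≠ VNP` is NOT proved.
-/

-- `Summit.ValiantsHypothesis.ValiantsHypothesis.…` is the tree's mandated single-conjunct layout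
-- (Sub = Summit), so the duplicated namespace component is intended.
set_option linter.dupNamespace false

namespace Summit.ValiantsHypothesis.ValiantsHypothesis.Theorems.SymPencilSymmetrizePermPairs.Dag

open Matrix Literature.LinearAlgebra.Matrix

variable {S : Type*} [CommRing S]

/-! ### Small Faddeev–LeVerrier facts on `Fin m` -/

/-- `N_m = 0` on `Fin m`. [folklore] -/
theorem flMat_fin_self {m : ℕ} (M : Matrix (Fin m) (Fin m) S) : flMat M m = 0 :=
  flMat_of_card_le M (by simp)

/-- `c_m = 1` on `Fin m` (the characteristic polynomial is monic of degree `m`). [folklore] -/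
theorem charpoly_coeff_fin_self {m : ℕ} (M : Matrix (Fin m) (Fin m) S) : M.charpoly.coeff m = 1 := by
  nontriviality S
  have h := M.charpoly_monic
  rw [Polynomial.Monic, Polynomial.leadingCoeff, Matrix.charpoly_natDegree_eq_dim, Fintype.card_fin] at h
  exact h

/-- The recursion `N_l(j,k) = (M N_{l+1})(j,k) + [j = k] c_{l+1}` entrywise on `Fin m`, valid for
every `l` (for `l = m - 1` it reads `N_{m-1} = 1`). [folklore] -/
theorem flMat_apply_eq {m : ℕ} (M : Matrix (Fin m) (Fin m) S) (l : ℕ) (j k : Fin m) :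
    flMat M l j k = (M * flMat M (l + 1)) j k + if j = k then M.charpoly.coeff (l + 1) else 0 := by
  rw [flMat_eq_mul_add M l, Matrix.add_apply, Matrix.smul_apply, Matrix.one_apply, smul_eq_mul,
    mul_ite, mul_one, mul_zero]

/-- The trace step `c_l = κ_l · tr(M N_l)` for `l < m`, `κ_l (m - l) = -1`. [folklore] -/
theorem charpoly_coeff_eq_kappa_mul {m : ℕ} (M : Matrix (Fin m) (Fin m) S) (κ : ℕ → S)
    (hκ : ∀ l < m, κ l * ((m - l : ℕ) : S) = -1) {l : ℕ} (hl : l < m) :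
    M.charpoly.coeff l = κ l * ∑ j, ∑ k, M k j * flMat M l j k := by
  have h := sub_mul_charpoly_coeff M (l := l) (by simpa using hl)
  rw [Fintype.card_fin] at h
  have htr : (M * flMat M l).trace = ∑ j, ∑ k, M k j * flMat M l j k := by
    rw [Matrix.trace, Finset.sum_comm]
    simp [Matrix.mul_apply]
  rw [← htr]
  have := hκ l hl
  linear_combination (M.charpoly.coeff l) * this - κ l * h

/-! ### The Le Verrier DAG of a family -/

/-- **The Le Verrier DAG of a covariant family.**  See the module docstring: an explicit graded
edge-weighted DAG on `((Fin R × (Fin m × (Fin m × Fin m))) ⊕ (Fin R × Fin m)) ⊕ Unit` (sink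
`Sum.inr ()`) whose path recursion is solved by the Faddeev–LeVerrier data of the family, whose
value is `Σ_i det(-M_i)`, whose weights are `0`, `1`, `M_i j k` or `κ_l · M_i j k`, whose source
weights are `0` or `1`, and which is covariant under block permutations composed with simultaneous
conjugations of the blocks. [folklore] -/
theorem exists_leVerrierDag (R m : ℕ) (hm : 1 ≤ m) (M : Fin R → Matrix (Fin m) (Fin m) S)
    (κ : ℕ → S) (hκ : ∀ l < m, κ l * ((m - l : ℕ) : S) = -1) :
    ∃ (E : Matrix (((Fin R × (Fin m × (Fin m × Fin m))) ⊕ (Fin R × Fin m)) ⊕ Unit)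
        (((Fin R × (Fin m × (Fin m × Fin m))) ⊕ (Fin R × Fin m)) ⊕ Unit) S)
      (b : ((Fin R × (Fin m × (Fin m × Fin m))) ⊕ (Fin R × Fin m)) ⊕ Unit → ℕ)
      (a y : ((Fin R × (Fin m × (Fin m × Fin m))) ⊕ (Fin R × Fin m)) ⊕ Unit → S),
      (∀ u v, E u v ≠ 0 → b u < b v) ∧
      y = E *ᵥ y + Pi.single (Sum.inr ()) 1 ∧
      a ⬝ᵥ y = ∑ i, (-M i).det ∧
      (∀ u v, E u v = 0 ∨ E u v = 1 ∨ (∃ i j k, E u v = M i j k) ∨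
        ∃ l i j k, E u v = κ l * M i j k) ∧
      (∀ v, a v = 0 ∨ a v = 1) ∧
      ∀ (φ : S →+* S) (τ : Equiv.Perm (Fin R)) (P : Fin R → Equiv.Perm (Fin m)),
        (∀ l, φ (κ l) = κ l) → (∀ i j k, φ (M i j k) = M (τ i) (P i j) (P i k)) →
        ∃ θ : Equiv.Perm (((Fin R × (Fin m × (Fin m × Fin m))) ⊕ (Fin R × Fin m)) ⊕ Unit),
          θ (Sum.inr ()) = Sum.inr () ∧ (∀ u v, φ (E u v) = E (θ u) (θ v)) ∧
          ∀ v, φ (a v) = a (θ v) := by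
  classical
  -- the edge weights
  let E : Matrix (((Fin R × (Fin m × (Fin m × Fin m))) ⊕ (Fin R × Fin m)) ⊕ Unit)
      (((Fin R × (Fin m × (Fin m × Fin m))) ⊕ (Fin R × Fin m)) ⊕ Unit) S :=
    Matrix.of fun u v =>
      match u, v with
      | Sum.inl (Sum.inl (i, l, j, k)), Sum.inl (Sum.inl (i', l', j', k')) =>
          if i' = i ∧ l'.val = l.val + 1 ∧ k' = k then M i j j' else 0
      | Sum.inl (Sum.inl (i, l, j, k)), Sum.inl (Sum.inr (i', l')) =>
          if i' = i ∧ l'.val = l.val + 1 ∧ j = k then 1 else 0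
      | Sum.inl (Sum.inl (_, l, j, k)), Sum.inr () => if l.val + 1 = m ∧ j = k then 1 else 0
      | Sum.inl (Sum.inr (i, l)), Sum.inl (Sum.inl (i', l', j', k')) =>
          if i' = i ∧ l' = l then κ l.val * M i k' j' else 0
      | Sum.inl (Sum.inr _), Sum.inl (Sum.inr _) => 0
      | Sum.inl (Sum.inr _), Sum.inr () => 0
      | Sum.inr (), _ => 0
  -- the grading
  let b : ((Fin R × (Fin m × (Fin m × Fin m))) ⊕ (Fin R × Fin m)) ⊕ Unit → ℕ := fun v =>
    match v with
    | Sum.inl (Sum.inl (_, l, _, _)) => 2 * l.val + 1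
    | Sum.inl (Sum.inr (_, l)) => 2 * l.val
    | Sum.inr () => 2 * m + 1
  -- the source weights and the value vector
  let a : ((Fin R × (Fin m × (Fin m × Fin m))) ⊕ (Fin R × Fin m)) ⊕ Unit → S := fun v =>
    match v with
    | Sum.inl (Sum.inl _) => 0
    | Sum.inl (Sum.inr (_, l)) => if l.val = 0 then 1 else 0
    | Sum.inr () => 0
  let y : ((Fin R × (Fin m × (Fin m × Fin m))) ⊕ (Fin R × Fin m)) ⊕ Unit → S := fun v =>
    match v with
    | Sum.inl (Sum.inl (i, l, j, k)) => flMat (M i) l.val j k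
    | Sum.inl (Sum.inr (i, l)) => (M i).charpoly.coeff l.val
    | Sum.inr () => 1
  refine ⟨E, b, a, y, ?_, ?_, ?_, ?_, ?_, ?_⟩
  · -- graded
    rintro ((⟨i, l, j, k⟩ | ⟨i, l⟩) | ⟨⟩) ((⟨i', l', j', k'⟩ | ⟨i', l'⟩) | ⟨⟩) h <;>
      simp only [E, Matrix.of_apply] at h <;> simp only [b]
    · split_ifs at h with hc
      · omega
      · exact absurd rfl h
    · split_ifs at h with hc
      · omega
      · exact absurd rfl h
    · split_ifs at h with hc
      · omega
      · exact absurd rfl h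
    · split_ifs at h with hc
      · obtain ⟨-, rfl⟩ := hc
        omega
      · exact absurd rfl h
    all_goals exact absurd rfl h
  · -- the path recursion = Faddeev–LeVerrier
    funext u
    simp only [Pi.add_apply, Matrix.mulVec, dotProduct, Fintype.sum_sum_type, Fintype.sum_unique,
      Fintype.sum_prod_type]
    rcases u with ((⟨i, l, j, k⟩ | ⟨i, l⟩) | ⟨⟩)
    · -- `N^{(i)}_l(j,k)`
      have hsingle : (Pi.single (Sum.inr ()) (1 : S) :
          ((Fin R × (Fin m × (Fin m × Fin m))) ⊕ (Fin R × Fin m)) ⊕ Unit → S)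
          (Sum.inl (Sum.inl (i, l, j, k))) = 0 := Pi.single_eq_of_ne (by simp) _
      rw [hsingle, add_zero]
      simp only [y, E, Matrix.of_apply]
      -- the `N → N` edges: `(M N_{l+1})(j,k)`
      have hNN : (∑ i', ∑ l' : Fin m, ∑ j', ∑ k' : Fin m,
          (if i' = i ∧ l'.val = l.val + 1 ∧ k' = k then M i j j' else 0) * flMat (M i') l'.val j' k') =
          (M i * flMat (M i) (l.val + 1)) j k := by
        rw [Finset.sum_eq_single i, Matrix.mul_apply]
        · by_cases hl : l.val + 1 < m
          · rw [Finset.sum_eq_single ⟨l.val + 1, hl⟩]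
            · refine Finset.sum_congr rfl fun j' _ => ?_
              rw [Finset.sum_eq_single k]
              · simp
              · intro k' _ hk'; simp [hk']
              · simp
            · intro l' _ hl'
              have : ¬ (l'.val = l.val + 1) := fun h => hl' (Fin.ext h)
              simp [this]
            · simp
          · have hflm : flMat (M i) (l.val + 1) = 0 := by
              rw [show l.val + 1 = m by omega]; exact flMat_fin_self _
            rw [hflm, Finset.sum_eq_zero]
            · simp
            · intro l' _
              have : ¬ (l'.val = l.val + 1) := by omega
              simp [this]
        · intro i' _ hi'; simp [hi']
        · simp
      -- the `N → c` edges and the `N → t` edge: `[j = k] c_{l+1}`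
      have hNc : (∑ i', ∑ l' : Fin m, (if i' = i ∧ l'.val = l.val + 1 ∧ j = k then (1 : S) else 0) *
            (M i').charpoly.coeff l'.val) +
          (if l.val + 1 = m ∧ j = k then (1 : S) else 0) * 1 =
          if j = k then (M i).charpoly.coeff (l.val + 1) else 0 := by
        rw [Finset.sum_eq_single i]
        · by_cases hl : l.val + 1 < m
          · rw [Finset.sum_eq_single ⟨l.val + 1, hl⟩]
            · have : ¬ (l.val + 1 = m) := by omega
              by_cases hjk : j = k <;> simp [hjk, this]
            · intro l' _ hl'
              have : ¬ (l'.val = l.val + 1) := fun h => hl' (Fin.ext h)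
              simp [this]
            · simp
          · have hlm : l.val + 1 = m := by omega
            rw [Finset.sum_eq_zero, hlm, charpoly_coeff_fin_self]
            · by_cases hjk : j = k <;> simp [hjk]
            · intro l' _
              have : ¬ (l'.val = l.val + 1) := by omega
              simp [this]
        · intro i' _ hi'; simp [hi']
        · simp
      rw [add_assoc, hNN, hNc]
      exact flMat_apply_eq (M i) l.val j k
    · -- `c^{(i)}_l`
      have hsingle : (Pi.single (Sum.inr ()) (1 : S) :
          ((Fin R × (Fin m × (Fin m × Fin m))) ⊕ (Fin R × Fin m)) ⊕ Unit → S)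
          (Sum.inl (Sum.inr (i, l))) = 0 := Pi.single_eq_of_ne (by simp) _
      rw [hsingle, add_zero]
      simp only [y, E, Matrix.of_apply, zero_mul, Finset.sum_const_zero, add_zero]
      rw [charpoly_coeff_eq_kappa_mul (M i) κ hκ l.isLt,
        Finset.sum_eq_single_of_mem i (Finset.mem_univ i)]
      · symm
        rw [Finset.sum_eq_single_of_mem l (Finset.mem_univ l)]
        · simp [Finset.mul_sum, mul_assoc]
        · intro l' _ hl'; simp [hl']
      · intro i' _ hi'; simp [hi']
    · -- the sink
      simp [y, E]
  · -- the value
    simp only [dotProduct, Fintype.sum_sum_type, Fintype.sum_prod_type, a, y,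
      zero_mul, Finset.sum_const_zero, zero_add, add_zero]
    refine Finset.sum_congr rfl fun i _ => ?_
    rw [Finset.sum_eq_single ⟨0, hm⟩]
    · simp [charpoly_coeff_zero_eq_det_neg]
    · intro l' _ hl'
      have : ¬ (l'.val = 0) := fun h => hl' (Fin.ext h)
      simp [this]
    · simp
  · -- shapes of the weights
    rintro ((⟨i, l, j, k⟩ | ⟨i, l⟩) | ⟨⟩) ((⟨i', l', j', k'⟩ | ⟨i', l'⟩) | ⟨⟩) <;>
      simp only [E, Matrix.of_apply]
    · by_cases h : i' = i ∧ l'.val = l.val + 1 ∧ k' = k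
      · exact Or.inr (Or.inr (Or.inl ⟨i, j, j', by rw [if_pos h]⟩))
      · exact Or.inl (if_neg h)
    · by_cases h : i' = i ∧ l'.val = l.val + 1 ∧ j = k
      · exact Or.inr (Or.inl (if_pos h))
      · exact Or.inl (if_neg h)
    · by_cases h : l.val + 1 = m ∧ j = k
      · exact Or.inr (Or.inl (if_pos h))
      · exact Or.inl (if_neg h)
    · by_cases h : i' = i ∧ l' = l
      · exact Or.inr (Or.inr (Or.inr ⟨l.val, i, k', j', by rw [if_pos h]⟩))
      · exact Or.inl (if_neg h)
    all_goals simp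
  · -- shapes of the source weights
    rintro ((⟨i, l, j, k⟩ | ⟨i, l⟩) | ⟨⟩) <;> simp only [a]
    · simp
    · by_cases h : l.val = 0
      · exact Or.inr (if_pos h)
      · exact Or.inl (if_neg h)
    · simp
  · -- covariance
    intro φ τ P hφκ hφM
    let θf : ((Fin R × (Fin m × (Fin m × Fin m))) ⊕ (Fin R × Fin m)) ⊕ Unit →
        ((Fin R × (Fin m × (Fin m × Fin m))) ⊕ (Fin R × Fin m)) ⊕ Unit := fun v =>
      match v with
      | Sum.inl (Sum.inl (i, l, j, k)) => Sum.inl (Sum.inl (τ i, l, P i j, P i k))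
      | Sum.inl (Sum.inr (i, l)) => Sum.inl (Sum.inr (τ i, l))
      | Sum.inr () => Sum.inr ()
    let θg : ((Fin R × (Fin m × (Fin m × Fin m))) ⊕ (Fin R × Fin m)) ⊕ Unit →
        ((Fin R × (Fin m × (Fin m × Fin m))) ⊕ (Fin R × Fin m)) ⊕ Unit := fun v =>
      match v with
      | Sum.inl (Sum.inl (i, l, j, k)) =>
          Sum.inl (Sum.inl (τ.symm i, l, (P (τ.symm i)).symm j, (P (τ.symm i)).symm k))
      | Sum.inl (Sum.inr (i, l)) => Sum.inl (Sum.inr (τ.symm i, l))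
      | Sum.inr () => Sum.inr ()
    let θ : Equiv.Perm (((Fin R × (Fin m × (Fin m × Fin m))) ⊕ (Fin R × Fin m)) ⊕ Unit) :=
      { toFun := θf
        invFun := θg
        left_inv := by
          rintro ((⟨i, l, j, k⟩ | ⟨i, l⟩) | ⟨⟩) <;> simp [θf, θg]
        right_inv := by
          rintro ((⟨i, l, j, k⟩ | ⟨i, l⟩) | ⟨⟩) <;> simp [θf, θg] }
    refine ⟨θ, rfl, ?_, ?_⟩
    · rintro ((⟨i, l, j, k⟩ | ⟨i, l⟩) | ⟨⟩) ((⟨i', l', j', k'⟩ | ⟨i', l'⟩) | ⟨⟩) <;>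
        simp only [θ, θf, Equiv.coe_fn_mk, E, Matrix.of_apply, map_zero]
      · by_cases hi : i' = i
        · subst hi
          simp [apply_ite φ, hφM]
        · have hi' : τ i' ≠ τ i := fun h => hi (τ.injective h)
          simp [hi, hi']
      · by_cases hi : i' = i
        · subst hi
          simp [apply_ite φ]
        · have hi' : τ i' ≠ τ i := fun h => hi (τ.injective h)
          simp [hi, hi']
      · simp [apply_ite φ]
      · by_cases hi : i' = i
        · subst hi
          simp [apply_ite φ, hφM, hφκ]
        · have hi' : τ i' ≠ τ i := fun h => hi (τ.injective h)
          simp [hi, hi']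
    · rintro ((⟨i, l, j, k⟩ | ⟨i, l⟩) | ⟨⟩) <;>
        simp [θ, θf, a, apply_ite φ]

/-- The vertex count of the Le Verrier DAG: `R (m³ + m) + 1`. [folklore] -/
theorem card_leVerrierDag_vertices (R m : ℕ) :
    Fintype.card (((Fin R × (Fin m × (Fin m × Fin m))) ⊕ (Fin R × Fin m)) ⊕ Unit) =
      R * (m ^ 3 + m) + 1 := by
  simp only [Fintype.card_sum, Fintype.card_prod, Fintype.card_fin, Fintype.card_unit]
  ring

end Summit.ValiantsHypothesis.ValiantsHypothesis.Theorems.SymPencilSymmetrizePermPairs.Dag
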